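import Literature.Algebra.EuclideanLattices.CosetGaussianMass
import Literature.Analysis.FunctionSpaces.BesselKSmallArgument
import Literature.Analysis.FunctionSpaces.BesselKLargeArgument
import Literature.Analysis.FunctionSpaces.BesselKExpMellin

/-!
(SPLIT FOR THE 400-LINE CAP by the landing lane, hand-2 g30: this file = part 1 of 2; sequels `…OverbindingBudgetAffineLayerPoisson` import it in a chain; same namespace, all FQNs unchanged.)
# Overbinding budget, affine far-core cell (31280 Z2): registry insensitivity of inverse-power
# layer sums — the Poisson–Bessel (incomplete Bessel / Chowla–Selberg type) expansion

For a full lattice `L` of an `n`-dimensional real inner product space `V`, `c > 0`, a natural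
exponent `σ` with `n < 2σ` and a shift `x ∈ V`, the shifted Epstein-type sum
`F(x) = Σ_{y ∈ L} (‖y − x‖² + c)^{−σ}` satisfies the EXACT dual expansion

  `F(0) − F(x) = (2 √π ^ n / (Γ(σ) · covol L)) · Σ_{w ∈ L*} (1 − cos 2π⟪x,w⟫) (π‖w‖/√c)^μ K_μ(2π√c‖w‖)`,
  `μ = σ − n/2`

(`theorem tsum_inv_pow_sub_tsum_inv_pow_shift_eq`), hence `0 ≤ F(0) − F(x) ≤ (4 √π ^ n / (Γ(σ) covol L))
· Σ_{w ≠ 0} (π‖w‖/√c)^μ K_μ(2π√c‖w‖)` (`theorem tsum_inv_pow_shift_spread_le`): the dependence of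
an inverse-power LAYER SUM on the in-plane registry (shift) of the layer is exponentially small in
`√c ·` (shortest dual vector), with the modified Bessel function `K_μ` (`besselKReal`) carrying the
decay.  This is the analytic leaf (IV) of the evaluation architecture of the far-core window
certificates (`OverbindingBudgetAffineFarCoreWindows`, memo NODE-g65 §8): applied to the far
layers `|k| ≥ 4` of a Barlow stacking (`n = 2`, `σ ∈ {3, 6}`, `c = c_k ≈ 2k²/3`) it bounds the
coset spread `max_o S_k(o) − min_o S_k(o)` by `≈ 7.6·10⁻¹⁰` at `k = 4`; the same statement is the
engine named by route PoissonBesselStacking's support `RegistryCouplingBesselTail`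
(stmt-AtomisticToContinuum-3068).

Proof = Gamma subordination `a^{−σ} = Γ(σ)⁻¹ ∫₀^∞ u^{σ−1} e^{−au} du`
(`Real.integral_rpow_mul_exp_neg_mul_Ioi`), Tonelli (`integral_tsum_of_summable_integral_norm`,
summability from `ZLattice.summable_norm_sub_inv_pow`), the Poisson identity for Gaussians over `L`
at every scale (`tsum_gaussianFunction_sub_eq`, Banaszczyk / Micciancio–Regev form, tree file
`GaussianLatticeSums`), a second Tonelli over the dual lattice, and the Mellin–Bessel integral
`∫₀^∞ u^{μ−1} e^{−(Au + B/u)} du = 2 (B/A)^{μ/2} K_μ(2√(AB))` (`integral_rpow_mul_exp_neg_mul_sub_div`,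
tree file `BesselKMellin`).  The dual Bessel family is summable over ANY lattice
(`summable_rpow_mul_besselKReal`, from the large-argument bound `‖K_μ(y)‖ ≤ 74 e^{−y}/√y`,
`y ≥ 1 + μ²`, tree file `BesselKLargeArgument`, and `ZLattice.summable_norm_rpow`), so both results
are UNCONDITIONAL; no `sorry`, imports = three Literature files.
[folklore: Lennard-Jones–Dent 1928; Steele 1973 (surface science); Terras, *Harmonic analysis on
symmetric spaces* I §1.4 (incomplete Bessel expansions of Epstein zeta functions)]
-/

noncomputable section

open MeasureTheory Set Module
open scoped Real InnerProductSpace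

namespace Summit.AtomisticToContinuum.Crystallization.Theorems.OverbindingBudgetAffineFarSmoothSplit

open Literature.Algebra.EuclideanLattices Literature.Analysis.FunctionSpaces

variable {V : Type*} [NormedAddCommGroup V] [InnerProductSpace ℝ V] [FiniteDimensional ℝ V]
  [MeasurableSpace V] [BorelSpace V]
variable (L : Submodule ℤ V) [DiscreteTopology L] [IsZLattice ℝ L]

/-! ## §1 The Poisson identity at one Gaussian scale, activity form -/

/-- `ρ_{(√(π/u))⁻¹}(w) = e^{−π²‖w‖²/u}`: the dual Gaussian of the activity-`u` Gaussian. [folklore] -/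
theorem gaussianFunction_inv_sqrt_pi_div {W : Type*} [NormedAddCommGroup W] {u : ℝ} (hu : 0 < u)
    (w : W) :
    gaussianFunction (Real.sqrt (π / u))⁻¹ w = Real.exp (-(π ^ 2 * ‖w‖ ^ 2 / u)) := by
  rw [gaussianFunction, inv_pow, Real.sq_sqrt (div_pos Real.pi_pos hu).le]
  congr 1
  field_simp

/-- The activity-`u` Gaussian sum over the shifted lattice, `Θ_L(u; x) = Σ_{y ∈ L} e^{−u‖y − x‖²}`.
[folklore] -/
def thetaShift (u : ℝ) (x : V) : ℝ := ∑' y : L, Real.exp (-u * ‖(y : V) - x‖ ^ 2)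

/-- **Registry dependence at one scale (Poisson).** For `u > 0`,
`Θ_L(u;0) − Θ_L(u;x) = covol⁻¹ (√(π/u))ⁿ Σ_{w ∈ L*} e^{−π²‖w‖²/u} (1 − cos 2π⟪x,w⟫)`. [folklore] -/
theorem thetaShift_zero_sub_eq {u : ℝ} (hu : 0 < u) (x : V) :
    thetaShift L u 0 - thetaShift L u x =
      (ZLattice.covolume L)⁻¹ * Real.sqrt (π / u) ^ finrank ℝ V *
        ∑' w : dualLattice L, Real.exp (-(π ^ 2 * ‖(w : V)‖ ^ 2 / u)) *
          (1 - Real.cos (2 * π * ⟪x, (w : V)⟫_ℝ)) := by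
  have hs : 0 < Real.sqrt (π / u) := Real.sqrt_pos.2 (div_pos Real.pi_pos hu)
  have h0 : thetaShift L u 0 = ∑' y : L, gaussianFunction (Real.sqrt (π / u)) ((y : V)) := by
    unfold thetaShift
    refine tsum_congr fun y => ?_
    rw [sub_zero, gaussianFunction_sqrt_pi_div hu]
  have hx : thetaShift L u x = ∑' y : L, gaussianFunction (Real.sqrt (π / u)) ((y : V) - x) := by
    unfold thetaShift
    refine tsum_congr fun y => ?_
    rw [gaussianFunction_sqrt_pi_div hu]
  rw [h0, hx, tsum_gaussianFunction_eq L hs, tsum_gaussianFunction_sub_eq L hs x, ← mul_sub]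
  congr 1
  have hA : Summable fun w : dualLattice L => gaussianFunction (Real.sqrt (π / u))⁻¹ (w : V) :=
    (summable_gaussianFunction_sub (dualLattice L) (inv_ne_zero hs.ne') (0 : V)).congr
      fun w => by rw [sub_zero]
  have hB := summable_gaussianFunction_mul_cos (dualLattice L) (inv_ne_zero hs.ne') x
  rw [← hA.tsum_sub hB]
  refine tsum_congr fun w => ?_
  rw [gaussianFunction_inv_sqrt_pi_div hu]
  ring

omit [FiniteDimensional ℝ V] [MeasurableSpace V] [BorelSpace V] [DiscreteTopology L]
  [IsZLattice ℝ L] in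
/-- Each dual term is nonnegative. [folklore] -/
theorem dualTerm_nonneg (u : ℝ) (x : V) (w : dualLattice L) :
    0 ≤ Real.exp (-(π ^ 2 * ‖(w : V)‖ ^ 2 / u)) * (1 - Real.cos (2 * π * ⟪x, (w : V)⟫_ℝ)) :=
  mul_nonneg (Real.exp_nonneg _) (by linarith [Real.cos_le_one (2 * π * ⟪x, (w : V)⟫_ℝ)])


/-! ## §2 Gamma subordination and the first Tonelli: `F(x)` as an integral of `Θ_L(u; x)` -/

/-- `(a^σ)⁻¹ = Γ(σ)⁻¹ ∫₀^∞ u^{σ−1} e^{−au} du` for `a > 0`, `σ ≥ 1`. [folklore] -/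
theorem inv_pow_eq_inv_Gamma_mul_integral (σ : ℕ) (hσ : 0 < σ) {a : ℝ} (ha : 0 < a) :
    (a ^ σ)⁻¹ = (Real.Gamma σ)⁻¹ * ∫ u in Ioi (0 : ℝ), u ^ ((σ : ℝ) - 1) * Real.exp (-(a * u)) := by
  have hσ' : (0 : ℝ) < σ := by exact_mod_cast hσ
  rw [Real.integral_rpow_mul_exp_neg_mul_Ioi hσ' ha, Real.rpow_natCast, one_div, inv_pow]
  have hG : Real.Gamma σ ≠ 0 := (Real.Gamma_pos_of_pos hσ').ne'
  field_simp

omit [MeasurableSpace V] [BorelSpace V] in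
/-- Summability of the shifted inverse-power family over the lattice (`2σ > n`). [folklore] -/
theorem summable_inv_norm_sub_sq_add_pow (σ : ℕ) (hσ : finrank ℝ V < 2 * σ) {c : ℝ} (hc : 0 < c)
    (x : V) : Summable fun y : L => ((‖(y : V) - x‖ ^ 2 + c) ^ σ)⁻¹ := by
  have hrank : finrank ℤ L = finrank ℝ V := ZLattice.rank ℝ L
  have h1 : Summable fun y : L => ‖(y : V) - x‖⁻¹ ^ (2 * σ) :=
    ZLattice.summable_norm_sub_inv_pow L (2 * σ) (by omega) x
  have hfin : ({y : L | (y : V) = x} : Set L).Finite :=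
    Set.Subsingleton.finite fun y₁ h₁ y₂ h₂ => Subtype.ext (h₁.trans h₂.symm)
  refine h1.of_norm_bounded_eventually (Filter.eventually_cofinite.2 (hfin.subset fun y hy => ?_))
  simp only [Set.mem_setOf_eq] at hy ⊢
  by_contra hne
  apply hy
  have hpos : 0 < ‖(y : V) - x‖ := norm_pos_iff.2 (sub_ne_zero.2 hne)
  rw [Real.norm_of_nonneg (by positivity), inv_pow, pow_mul]
  exact inv_anti₀ (pow_pos (by positivity) σ) (pow_le_pow_left₀ (sq_nonneg _) (by linarith) σ)

omit [MeasurableSpace V] [BorelSpace V] in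
/-- Positivity of the shifted inverse-power sum. [folklore] -/
theorem tsum_inv_norm_sub_sq_add_pow_pos (σ : ℕ) (hσ : finrank ℝ V < 2 * σ) {c : ℝ} (hc : 0 < c)
    (x : V) : 0 < ∑' y : L, ((‖(y : V) - x‖ ^ 2 + c) ^ σ)⁻¹ :=
  (summable_inv_norm_sub_sq_add_pow L σ hσ hc x).tsum_pos (fun y => by positivity) 0 (by positivity)

omit [MeasurableSpace V] [BorelSpace V] in
/-- **Gamma subordination + Tonelli:** `F(x) = Σ_{y∈L} (‖y−x‖²+c)^{−σ} = Γ(σ)⁻¹ ∫₀^∞ u^{σ−1} e^{−cu} Θ_L(u;x) du`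
(`2σ > n`, `c > 0`). [folklore] -/
theorem tsum_inv_pow_eq_integral_thetaShift (σ : ℕ) (hσ : finrank ℝ V < 2 * σ) {c : ℝ} (hc : 0 < c)
    (x : V) :
    ∑' y : L, ((‖(y : V) - x‖ ^ 2 + c) ^ σ)⁻¹ =
      (Real.Gamma σ)⁻¹ * ∫ u in Ioi (0 : ℝ), u ^ ((σ : ℝ) - 1) * (Real.exp (-(c * u)) * thetaShift L u x) := by
  have hσ0 : 0 < σ := by omega
  have hσ' : (0 : ℝ) < σ := by exact_mod_cast hσ0
  have hG : 0 < Real.Gamma σ := Real.Gamma_pos_of_pos hσ'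
  -- the subordinated family
  set g : L → ℝ → ℝ := fun y u => u ^ ((σ : ℝ) - 1) * Real.exp (-((‖(y : V) - x‖ ^ 2 + c) * u))
    with hg
  have ha : ∀ y : L, 0 < ‖(y : V) - x‖ ^ 2 + c := fun y => by positivity
  have hval : ∀ y : L, ∫ u in Ioi (0 : ℝ), g y u = Real.Gamma σ * ((‖(y : V) - x‖ ^ 2 + c) ^ σ)⁻¹ := by
    intro y
    rw [inv_pow_eq_inv_Gamma_mul_integral σ hσ0 (ha y)]
    simp only [hg]
    field_simp
  have hint : ∀ y : L, Integrable (g y) (volume.restrict (Ioi (0 : ℝ))) := by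
    intro y
    refine Integrable.of_integral_ne_zero ?_
    rw [hval y]
    exact (mul_pos hG (by positivity)).ne'
  have hnn : ∀ y : L, ∀ u ∈ Ioi (0 : ℝ), 0 ≤ g y u := fun y u hu => by
    have hu : 0 < u := hu
    positivity
  have hnorm : ∀ y : L, ∫ u in Ioi (0 : ℝ), ‖g y u‖ = ∫ u in Ioi (0 : ℝ), g y u := fun y =>
    setIntegral_congr_fun measurableSet_Ioi fun u hu => Real.norm_of_nonneg (hnn y u hu)
  have hsum : Summable fun y : L => ∫ u in Ioi (0 : ℝ), ‖g y u‖ := by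
    simp_rw [hnorm, hval]
    exact (summable_inv_norm_sub_sq_add_pow L σ hσ hc x).mul_left _
  -- pointwise: Σ_y g y u = u^{σ-1} e^{-cu} Θ(u;x)
  have hpt : ∀ u : ℝ, ∑' y : L, g y u = u ^ ((σ : ℝ) - 1) * (Real.exp (-(c * u)) * thetaShift L u x) := by
    intro u
    simp only [hg, thetaShift]
    rw [← tsum_mul_left, ← tsum_mul_left]
    refine tsum_congr fun y => ?_
    rw [show -((‖(y : V) - x‖ ^ 2 + c) * u) = -(c * u) + -u * ‖(y : V) - x‖ ^ 2 by ring,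
      Real.exp_add]
  calc ∑' y : L, ((‖(y : V) - x‖ ^ 2 + c) ^ σ)⁻¹
      = ∑' y : L, (Real.Gamma σ)⁻¹ * ∫ u in Ioi (0 : ℝ), g y u := by
        refine tsum_congr fun y => ?_
        rw [hval y]
        field_simp
    _ = (Real.Gamma σ)⁻¹ * ∑' y : L, ∫ u in Ioi (0 : ℝ), g y u := tsum_mul_left
    _ = (Real.Gamma σ)⁻¹ * ∫ u in Ioi (0 : ℝ), ∑' y : L, g y u := by
        rw [integral_tsum_of_summable_integral_norm hint hsum]
    _ = _ := by simp_rw [hpt]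

/-! ## §3 The second Tonelli over the dual lattice and the Mellin–Bessel evaluation -/

/-- `(√(π/u))ⁿ = (√π)ⁿ u^{−n/2}` for `u > 0`. [folklore] -/
theorem sqrt_pi_div_pow {u : ℝ} (hu : 0 < u) (n : ℕ) :
    Real.sqrt (π / u) ^ n = Real.sqrt π ^ n * u ^ (-((n : ℝ) / 2)) := by
  rw [Real.sqrt_div' π hu.le, div_pow, Real.rpow_neg hu.le, div_eq_mul_inv]
  congr 2
  rw [Real.sqrt_eq_rpow, ← Real.rpow_natCast, ← Real.rpow_mul hu.le]
  congr 1
  ring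

/-- The Mellin–Bessel evaluation of the dual core integral for a nonzero dual vector:
`∫₀^∞ u^{μ−1} e^{−(cu + π²‖w‖²/u)} du = 2 (π‖w‖/√c)^μ K_μ(2π√c‖w‖)`. [folklore] -/
theorem integral_core_eq_besselKReal {W : Type*} [NormedAddCommGroup W] {c : ℝ} (hc : 0 < c)
    (μ : ℝ) {w : W} (hw : w ≠ 0) :
    (∫ u in Ioi (0 : ℝ), u ^ (μ - 1) * Real.exp (-(c * u + π ^ 2 * ‖w‖ ^ 2 / u))) =
        2 * (π * ‖w‖ / Real.sqrt c) ^ μ * besselKReal μ (2 * π * Real.sqrt c * ‖w‖) ∧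
      IntegrableOn (fun u : ℝ => u ^ (μ - 1) * Real.exp (-(c * u + π ^ 2 * ‖w‖ ^ 2 / u)))
        (Ioi 0) := by
  have hwpos : 0 < ‖w‖ := norm_pos_iff.2 hw
  have hB : 0 < π ^ 2 * ‖w‖ ^ 2 := by positivity
  obtain ⟨hval, hint⟩ := integral_rpow_mul_exp_neg_mul_sub_div hc hB μ
  refine ⟨?_, hint⟩
  rw [hval]
  have h1 : Real.sqrt (π ^ 2 * ‖w‖ ^ 2 / c) = π * ‖w‖ / Real.sqrt c := by
    rw [Real.sqrt_div' _ hc.le, show π ^ 2 * ‖w‖ ^ 2 = (π * ‖w‖) ^ 2 by ring,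
      Real.sqrt_sq (by positivity)]
  have h2 : 2 * Real.sqrt (c * (π ^ 2 * ‖w‖ ^ 2)) = 2 * π * Real.sqrt c * ‖w‖ := by
    rw [Real.sqrt_mul hc.le, show π ^ 2 * ‖w‖ ^ 2 = (π * ‖w‖) ^ 2 by ring,
      Real.sqrt_sq (by positivity)]
    ring
  rw [h1, h2, ← ofReal_besselKReal, Complex.ofReal_re]

/-- The dual Bessel term is nonnegative (it vanishes at `w = 0` since `0^μ = 0`, `μ > 0`). [folklore] -/
theorem besselTerm_nonneg {W : Type*} [NormedAddCommGroup W] {μ c : ℝ} (hμ : 0 < μ) (hc : 0 < c)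
    (w : W) : 0 ≤ (π * ‖w‖ / Real.sqrt c) ^ μ * besselKReal μ (2 * π * Real.sqrt c * ‖w‖) := by
  by_cases hw : w = 0
  · simp [hw, Real.zero_rpow hμ.ne']
  · exact mul_nonneg (Real.rpow_nonneg (by positivity) _)
      (besselKReal_pos μ (by positivity [norm_pos_iff.2 hw])).le

-- `rpow_mul_exp_neg_le_rpow` of the seat file (x^a e^{-x} ≤ a^a e^{-a}) IS the tree's
-- `Literature.Analysis.FunctionSpaces.rpow_mul_exp_neg_le` (BesselKExpMellin); deleted here and cited instead (dedup gate, p850042).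

omit [MeasurableSpace V] [BorelSpace V] in
/-- Norms of lattice vectors in a ball form a finite set. [folklore] -/
theorem finite_norm_le (Λ : Submodule ℤ V) [DiscreteTopology Λ] (R : ℝ) :
    {v : Λ | ‖(v : V)‖ ≤ R}.Finite := by
  have h : (Metric.closedBall (0 : V) R ∩ (Λ : Set V)).Finite := by
    change ((_ : Set V) ∩ Λ.toAddSubgroup).Finite
    have : DiscreteTopology Λ.toAddSubgroup := (inferInstance : DiscreteTopology Λ)
    exact Metric.finite_isBounded_inter_isClosed DiscreteTopology.isDiscrete
      Metric.isBounded_closedBall inferInstance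
  refine (h.preimage Subtype.val_injective.injOn).subset fun v hv => ?_
  exact ⟨mem_closedBall_zero_iff.2 hv, v.2⟩

omit [MeasurableSpace V] [BorelSpace V] in
/-- **Summability of the dual Bessel family** `w ↦ (π‖w‖/√c)^μ K_μ(2π√c‖w‖)` over any lattice
(`μ, c > 0`): by the large-argument bound `‖K_μ(y)‖ ≤ 74e^{−y}/√y` (`y ≥ 1 + μ²`, Iwaniec (B.36)) and
`y^{μ+m}e^{−y} ≤ (μ+m)^{μ+m}e^{−(μ+m)}`, the terms are eventually `≤ M‖w‖^{−m}` with `m = rank + 1`.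
[cite: Iwaniec2002, Appendix B.4 (B.36)] -/
theorem summable_rpow_mul_besselKReal (Λ : Submodule ℤ V) [DiscreteTopology Λ] [IsZLattice ℝ Λ]
    {μ c : ℝ} (hμ : 0 < μ) (hc : 0 < c) :
    Summable fun w : Λ =>
      (π * ‖(w : V)‖ / Real.sqrt c) ^ μ * besselKReal μ (2 * π * Real.sqrt c * ‖(w : V)‖) := by
  set b : ℝ := 2 * π * Real.sqrt c with hb
  have hs0 : 0 < Real.sqrt c := Real.sqrt_pos.2 hc
  have hsq : Real.sqrt c * Real.sqrt c = c := Real.mul_self_sqrt hc.le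
  have hbpos : 0 < b := by positivity
  set m : ℕ := finrank ℤ Λ + 1 with hm
  have hr : (-(m : ℝ)) < -(finrank ℤ Λ : ℝ) := by rw [hm]; push_cast; linarith
  have hΛs : Summable fun v : Λ => ‖v‖ ^ (-(m : ℝ)) := ZLattice.summable_norm_rpow Λ _ hr
  have hmpos : (0 : ℝ) < m := by rw [hm]; positivity
  set M : ℝ := 74 * (1 / (2 * c)) ^ μ * ((μ + m) ^ (μ + m) * Real.exp (-(μ + m))) *
    b ^ (-(m : ℝ)) with hM
  have hcs : Real.sqrt c / c = 1 / Real.sqrt c := by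
    rw [eq_div_iff hs0.ne', div_mul_eq_mul_div, hsq, div_self hc.ne']
  -- the eventual bound
  have key : ∀ v : Λ, 1 + μ ^ 2 ≤ b * ‖(v : V)‖ →
      (π * ‖(v : V)‖ / Real.sqrt c) ^ μ * besselKReal μ (2 * π * Real.sqrt c * ‖(v : V)‖) ≤
        M * ‖v‖ ^ (-(m : ℝ)) := by
    intro v hv
    have hy1 : 1 ≤ b * ‖(v : V)‖ := by nlinarith [sq_nonneg μ]
    have hy0 : 0 < b * ‖(v : V)‖ := by linarith
    have hv0 : 0 < ‖(v : V)‖ := by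
      rcases (norm_nonneg (v : V)).eq_or_lt with h | h
      · rw [← h, mul_zero] at hy0; exact absurd hy0 (lt_irrefl 0)
      · exact h
    have h1 : π * ‖(v : V)‖ / Real.sqrt c = (1 / (2 * c)) * (b * ‖(v : V)‖) := by
      calc π * ‖(v : V)‖ / Real.sqrt c = π * ‖(v : V)‖ * (Real.sqrt c / c) := by rw [hcs]; ring
        _ = (1 / (2 * c)) * (b * ‖(v : V)‖) := by rw [hb]; field_simp
    -- the Bessel factor
    have hK : besselKReal μ (2 * π * Real.sqrt c * ‖(v : V)‖) ≤ 74 * Real.exp (-(b * ‖(v : V)‖)) := by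
      have hlarge : 1 + ‖(μ : ℂ)‖ ^ 2 ≤ b * ‖(v : V)‖ := by
        rw [Complex.norm_real, Real.norm_eq_abs, sq_abs]; exact hv
      have h2 := norm_besselK_le_of_large hlarge
      have h3 : besselKReal μ (b * ‖(v : V)‖) ≤ ‖besselK (μ : ℂ) ((b * ‖(v : V)‖ : ℝ) : ℂ)‖ := by
        rw [← ofReal_besselKReal, Complex.norm_real, Real.norm_eq_abs]
        exact le_abs_self _
      have h4 : 74 * Real.exp (-(b * ‖(v : V)‖)) / Real.sqrt (b * ‖(v : V)‖) ≤
          74 * Real.exp (-(b * ‖(v : V)‖)) :=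
        div_le_self (by positivity) (Real.one_le_sqrt.2 hy1)
      rw [show 2 * π * Real.sqrt c * ‖(v : V)‖ = b * ‖(v : V)‖ by rw [hb]]
      linarith
    -- polynomial × exponential
    have hpe := rpow_mul_exp_neg_le (a := μ + m) (x := b * ‖(v : V)‖) (by linarith) hy0
    have hsplit : (b * ‖(v : V)‖) ^ μ = (b * ‖(v : V)‖) ^ (μ + m) * (b * ‖(v : V)‖) ^ (-(m : ℝ)) := by
      rw [Real.rpow_add hy0, Real.rpow_neg hy0.le,
        mul_inv_cancel_right₀ (Real.rpow_pos_of_pos hy0 _).ne']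
    have hneg : (b * ‖(v : V)‖) ^ (-(m : ℝ)) = b ^ (-(m : ℝ)) * ‖v‖ ^ (-(m : ℝ)) := by
      rw [Real.mul_rpow hbpos.le (norm_nonneg _), Submodule.coe_norm]
    have hc2 : 0 ≤ (1 / (2 * c)) ^ μ := Real.rpow_nonneg (by positivity) _
    have hyμ : 0 ≤ (b * ‖(v : V)‖) ^ μ := Real.rpow_nonneg hy0.le _
    have hym : 0 ≤ (b * ‖(v : V)‖) ^ (-(m : ℝ)) := Real.rpow_nonneg hy0.le _
    calc (π * ‖(v : V)‖ / Real.sqrt c) ^ μ * besselKReal μ (2 * π * Real.sqrt c * ‖(v : V)‖)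
        = (1 / (2 * c)) ^ μ * ((b * ‖(v : V)‖) ^ μ *
            besselKReal μ (2 * π * Real.sqrt c * ‖(v : V)‖)) := by
          rw [h1, Real.mul_rpow (by positivity) hy0.le, mul_assoc]
      _ ≤ (1 / (2 * c)) ^ μ * ((b * ‖(v : V)‖) ^ μ * (74 * Real.exp (-(b * ‖(v : V)‖)))) :=
          mul_le_mul_of_nonneg_left (mul_le_mul_of_nonneg_left hK hyμ) hc2
      _ = 74 * (1 / (2 * c)) ^ μ * (((b * ‖(v : V)‖) ^ (μ + m) * Real.exp (-(b * ‖(v : V)‖))) *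
            (b * ‖(v : V)‖) ^ (-(m : ℝ))) := by rw [hsplit]; ring
      _ ≤ 74 * (1 / (2 * c)) ^ μ * (((μ + m) ^ (μ + m) * Real.exp (-(μ + m))) *
            (b * ‖(v : V)‖) ^ (-(m : ℝ))) :=
          mul_le_mul_of_nonneg_left (mul_le_mul_of_nonneg_right hpe hym) (by positivity)
      _ = M * ‖v‖ ^ (-(m : ℝ)) := by rw [hneg, hM]; ring
  -- conclude by comparison off a finite set
  refine (hΛs.mul_left M).of_norm_bounded_eventually ?_
  refine Filter.eventually_cofinite.2 ((finite_norm_le Λ ((1 + μ ^ 2) / b)).subset fun v hv => ?_)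
  simp only [Set.mem_setOf_eq] at hv ⊢
  by_contra hlt
  rw [not_le] at hlt
  refine hv ?_
  rw [Real.norm_of_nonneg (besselTerm_nonneg hμ hc (v : V))]
  exact key v (by rw [div_lt_iff₀ hbpos] at hlt; linarith)

end Summit.AtomisticToContinuum.Crystallization.Theorems.OverbindingBudgetAffineFarSmoothSplit
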